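import Literature.Algebra.Homology.ExtPresentationObstruction
import Literature.Algebra.Homology.DiscreteRepExtInternalHomGalois
import Literature.NumberTheory.GaloisRepresentations.HomDualReadoutLocal
import Literature.NumberTheory.GaloisRepresentations.GalLayerSystemUnitsBar
import Literature.NumberTheory.GaloisRepresentations.GalLayerSystemSES
import Literature.NumberTheory.GaloisRepresentations.GalLayerSystemFreePresentationVanishing
import Literature.NumberTheory.GaloisRepresentations.PresentationOfFiniteGaloisModule
import HarnessLib

/-!
# The degree-`2` obstruction map `Ψ : Hom_{C_Γ}(N₁, C̄) → H²(K, M^D)` of the presentation road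
# (Milne *ADT* I Thm. 4.10 (a): `Ш²(K, M^D) ≅ Coker(Ext¹(M, J̄) → Ext¹(M, C̄))`), and three of its
# five properties: `Ψ(f ≫ g) = 0`, `Ψ(ι ≫ q) = 0`, `Ker Ψ = g_* Hom(N₁, J̄)`

Topic `NumberTheory/GaloisRepresentations`; namespace `Literature.NumberTheory.GaloisRepresentations.HomDual`.
Definitions with bodies (`extTwoToTateDual`, `shaTwoObstruction`) and theorems; no named fact, no instance, no
`sorry`.  Sequel of `ExtPresentationObstruction` (generic `Ψ(h) = [S] ∘ h ∘ [T] ∈ Ext²(N, X₁)`), of door-c4's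
`DiscreteRepExtInternalHomGalois` (`Extʳ_{C_Γ}(N, K̄ˣ) ≃+ Hʳ(K, Hom(N, K̄ˣ))`, Milne I 0.8) and of door-c6's
`HomDualReadoutLocal` (`tateDualUnitsIso : M^D ≅ Hom_ℤ(M, K̄ˣ)`).

THE MATHEMATICS.  `K` a number field, `n ≥ 1`, `ρ₀` a finite discrete `n`-torsion `Γ_K`-module on `M`, with
door-c4's presentation `S = presentationComplex ρ₀ : 0 → N₁ → ℤ[Gal(E₀/K)]ᵐ → M → 0` in `C_Γ` and door-c5's
`T = ideleClassLimitShortComplex K : 0 → F̄ˣ → J̄ → C̄ → 0`.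
* `extTwoToTateDual ρ₀ n hM : Ext²_{C_Γ}(M, F̄ˣ) →+ H²(K, M^D)` — `F̄ˣ = lim→ Eˣ ≅ K̄ˣ` (`unitsBarIso`), Milne I 0.8
  (`extAddEquivGaloisCohomologyHomUnits ρ₀ 2`), `Hom_ℤ(M, K̄ˣ) ≅ M^D` (`(tateDualUnitsIso)⁻¹`); INJECTIVE
  (`extTwoToTateDual_injective`: three bijections).
* **`shaTwoObstruction ρ₀ n hM : Hom_{C_Γ}(N₁, C̄) →+ H²(K, M^D)`**, `h ↦ extTwoToTateDual([S] ∘ h ∘ [T])` — THE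
  degree-`2` input `Ψ` of the `Ш²`-readout road (`PoitouTateShaTwoReadout.shaTwo_tateDual_of_ideleProjection`,
  cell `bsd-wall` seat chl-p2 g6), for which this file proves
  (a) `shaTwoObstruction_comp_g` : `Ψ(f ≫ g) = 0` (`f : N₁ → J̄`),
  (b) `shaTwoObstruction_f_comp` : `Ψ(ι ≫ q) = 0` (`q : ℤ[Gal(E₀/K)]ᵐ → C̄`),
  (c) `exists_comp_g_eq_of_shaTwoObstruction_eq_zero` : `Ψ h = 0 ⟹ h = f ≫ g` — from Hilbert 90 at the layers
  (`Ext¹_{C_Γ}(ℤ[Gal(E₀/K)]ᵐ, F̄ˣ) = 0`, door-c6 `FreePresentation.ext_presLattice_unitsBarD_eq_zero`) and the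
  generic chase `ExtPresentation.exists_comp_g_eq_of_obstruction_eq_zero`.
  §4 repeats the map on the spelling `C̄ = classBarD K` of the `Ш²`-readout road (`ideleClassSeq`, `shaTwoObstruction'`,
  `shaTwoObstruction'_apply : shaTwoObstruction' h = shaTwoObstruction h` by `rfl`, and (a)(b)(c) again) — the form that
  plugs into `PoitouTateShaTwoReadout.shaTwo_tateDual_of_ideleProjection` verbatim.  §5 defines the road's bridge
  `natOfBidual κ = (extTrivAddEquivGaloisCohomology ρ₀ 1)⁻¹ ∘ H¹(κ) : H¹(K, M^{DD}) →+ Ext¹_{C_Γ}(ℤ, S.X₃)` (bijective,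
  `natOfBidual_bijective`).
  The remaining two properties — (d) `Ψ h ∈ Ш²(K, M^D)` (local version of (c) through the idèle projections
  `π_v : J̄ → K̄_vˣ`) and (e) `Ш²(K, M^D) ⊆ Im Ψ` (Brauer–Hasse–Noether for `E₀` + Shapiro in degree `2`) — are NOT
  proved here.
HONEST FRAMING: no case of Poitou–Tate or BSD is proved here.

## References
* J. S. Milne, *Arithmetic Duality Theorems* (2nd ed. 2006), I §0 Example 0.8, I §4 proof of Theorem 4.10 (a)
  (p. 58), Lemma 4.13. [MilneADT2006]
* C. A. Weibel, *An introduction to homological algebra* (1994), §2.7, Thm. 2.7.6. [Weibel1994]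
-/

noncomputable section

namespace Literature.NumberTheory.GaloisRepresentations

namespace HomDual

open Function CategoryTheory CategoryTheory.Abelian Field
open Literature.Algebra.Homology Literature.Algebra.Homology.DiscreteRep Literature.Algebra.Homology.ExtPresentation
open Literature.NumberTheory.GaloisRepresentations.IdeleClassBar (classBarD)
open Literature.NumberTheory.GaloisRepresentations.FreePresentation (presentationComplex presentationComplex_shortExact
  presentationLayer presentationRank ext_presLattice_unitsBarD_eq_zero)
open DiscreteGaloisModule (units tateDual)

/-! ## §1 `H²(K, Hom_ℤ(M, K̄ˣ)) → H²(K, M^D)` -/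

section TateDualTwo

variable {K : Type} [Field K]
variable {M : Type} [AddCommGroup M] [TopologicalSpace M] [DiscreteTopology M] [Finite M]
  (ρ₀ : DiscreteGaloisModule K M) (n : ℕ) (hM : ∀ m : M, n • m = 0)

/-- **`H²(K, Hom_ℤ(M, K̄ˣ)) →+ H²(K, M^D)`** along `(tateDualUnitsIso)⁻¹ : Hom_ℤ(M, K̄ˣ) ≅ M^D` (door-c6), as the
tree's `galoisCohomology.map` with the implicit modules pinned. [cite: MilneADT2006, I §0, I §2] -/
def homUnitsToTateDualTwo : galoisCohomology (homGaloisModule ρ₀ (units K)) 2 →+ galoisCohomology (ρ₀.tateDual n) 2 :=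
  galoisCohomology.map (ρ := homGaloisModule ρ₀ (units K)) (ρ' := ρ₀.tateDual n) (tateDualUnitsIso K ρ₀ n hM).inv.hom 2

/-- `homUnitsToTateDualTwo` is bijective (induced by an isomorphism of coefficients). [cite: MilneADT2006, I §0, I §2] -/
theorem homUnitsToTateDualTwo_bijective : Bijective (homUnitsToTateDualTwo ρ₀ n hM) := by
  have h := (continuousCohomologyEquivOfIso (tateDualUnitsIso K ρ₀ n hM).symm 2).bijective
  exact h

end TateDualTwo

/-! ## §2 `Ext²_{C_Γ}(M, F̄ˣ) → H²(K, M^D)` -/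

section ExtTwo

variable {K : Type} [Field K] [NumberField K]
variable {M : Type} [AddCommGroup M] [TopologicalSpace M] [DiscreteTopology M] [Finite M]
  (ρ₀ : DiscreteGaloisModule K M) (n : ℕ) (hM : ∀ m : M, n • m = 0)

/-- `F̄ˣ = lim→ Eˣ ≅ K̄ˣ` (door-c5/c6 `unitsBarIso`) with its source spelled `T.X₁`. [cite: Harari2020, §13.1] -/
def unitsBarIsoT : (ideleClassLimitShortComplex K).X₁ ≅ ofDiscreteGaloisModule (units K) := unitsBarIso K

/-- `M` as the third object `S.X₃` of its canonical presentation (definitionally `ofDiscreteGaloisModule ρ₀`).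
[cite: MilneADT2006, I Lemma 1.9 (proof)] -/
def presX₃Iso : ofDiscreteGaloisModule ρ₀ ≅ (presentationComplex ρ₀).X₃ := Iso.refl _

/-- The change of spelling `Ext²(S.X₃, T.X₁) →+ Ext²(M, K̄ˣ)` (pre- and post-composition with the two isomorphisms above).
[cite: Weibel1994, §2.7] -/
def extCast : Ext (presentationComplex ρ₀).X₃ (ideleClassLimitShortComplex K).X₁ 2 →+
    Ext (ofDiscreteGaloisModule ρ₀) (ofDiscreteGaloisModule (units K)) 2 :=
  ((Ext.mk₀ (presX₃Iso ρ₀).hom).precomp (ofDiscreteGaloisModule (units K)) (zero_add 2)).comp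
    ((Ext.mk₀ (unitsBarIsoT (K := K)).hom).postcomp (presentationComplex ρ₀).X₃ (add_zero 2))

/-- Unfolding `extCast`. [cite: Weibel1994, §2.7] -/
theorem extCast_apply (x : Ext (presentationComplex ρ₀).X₃ (ideleClassLimitShortComplex K).X₁ 2) :
    extCast ρ₀ x = (Ext.mk₀ (presX₃Iso ρ₀).hom).comp (x.comp (Ext.mk₀ (unitsBarIsoT (K := K)).hom) (add_zero 2))
      (zero_add 2) := rfl

/-- `extCast` is injective (composition with isomorphisms). [cite: Weibel1994, §2.7] -/
theorem extCast_injective : Injective (extCast ρ₀) := by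
  intro x x' h
  rw [extCast_apply, extCast_apply] at h
  have h1 := congrArg (fun z => ((Ext.mk₀ (presX₃Iso ρ₀).inv).comp z (zero_add 2)).comp
    (Ext.mk₀ (unitsBarIsoT (K := K)).inv) (add_zero 2)) h
  simpa only [← Ext.comp_assoc_of_second_deg_zero, Ext.mk₀_comp_mk₀, Iso.inv_hom_id, Ext.mk₀_id_comp,
    Ext.comp_assoc_of_third_deg_zero, Iso.hom_inv_id, Ext.comp_mk₀_id] using h1

/-- **`Ext²_{C_Γ}(M, F̄ˣ) →+ H²(K, M^D)`** (source spelled `Ext²(S.X₃, T.X₁)`): change of spelling, then Milne I 0.8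
`Ext²_{C_Γ}(M, K̄ˣ) ≃ H²(K, Hom_ℤ(M, K̄ˣ))` (door-c4 `extAddEquivGaloisCohomologyHomUnits`), then `Hom_ℤ(M, K̄ˣ) ≅ M^D` on
`H²` (`homUnitsToTateDualTwo`). [cite: MilneADT2006, I §0 Example 0.8, I §4 Lemma 4.12] -/
def extTwoToTateDual :
    Ext (presentationComplex ρ₀).X₃ (ideleClassLimitShortComplex K).X₁ 2 →+ galoisCohomology (ρ₀.tateDual n) 2 :=
  haveI := absoluteGaloisGroup_compactSpace K
  haveI : Module.Finite ℤ M := Module.Finite.of_finite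
  (homUnitsToTateDualTwo ρ₀ n hM).comp <|
    (extAddEquivGaloisCohomologyHomUnits ρ₀ 2).toAddMonoidHom.comp (extCast ρ₀)

/-- **`extTwoToTateDual` is injective** (a composite of three injections). [cite: MilneADT2006, I §0 Example 0.8] -/
theorem extTwoToTateDual_injective : Injective (extTwoToTateDual ρ₀ n hM) := by
  haveI := absoluteGaloisGroup_compactSpace K
  haveI : Module.Finite ℤ M := Module.Finite.of_finite
  intro x x' h
  simp only [extTwoToTateDual, AddMonoidHom.coe_comp, Function.comp_apply, AddEquiv.coe_toAddMonoidHom] at h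
  have key : extAddEquivGaloisCohomologyHomUnits ρ₀ 2 (extCast ρ₀ x) =
      extAddEquivGaloisCohomologyHomUnits ρ₀ 2 (extCast ρ₀ x') :=
    (homUnitsToTateDualTwo_bijective ρ₀ n hM).1 (by convert h using 1)
  exact extCast_injective ρ₀ ((extAddEquivGaloisCohomologyHomUnits ρ₀ 2).injective key)

/-! ## §3 The obstruction map `Ψ` and three of its properties -/

/-- **THE degree-`2` obstruction map `Ψ : Hom_{C_Γ}(N₁, C̄) →+ H²(K, M^D)`** of the presentation road:
`h ↦ [S] ∘ h ∘ [T] ∈ Ext²_{C_Γ}(M, F̄ˣ)` (`ExtPresentation.obstruction` for door-c4's presentation `S` of `M` and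
door-c5's `T : 0 → F̄ˣ → J̄ → C̄ → 0`) read in `H²(K, M^D)` through `extTwoToTateDual`.  In Milne's proof of I 4.10 (a)
this is the map `Ext¹(M, C̄) → Ext²(M, K̄ˣ) = H²(K, M^D)` at the level of homomorphisms out of the relation module.
[cite: MilneADT2006, I Theorem 4.10 (proof)][cite: Weibel1994, §2.7] -/
def shaTwoObstruction : ((presentationComplex ρ₀).X₁ ⟶ (ideleClassLimitShortComplex K).X₃) →+
    galoisCohomology (ρ₀.tateDual n) 2 :=
  (extTwoToTateDual ρ₀ n hM).comp
    (obstruction (presentationComplex_shortExact ρ₀) (ideleClassLimitShortComplex_shortExact K))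

/-- **(a) `Ψ(f ≫ g) = 0`**: a homomorphism `N₁ → C̄` that lifts to `J̄` has no obstruction.
[cite: MilneADT2006, I Theorem 4.10 (proof)] -/
theorem shaTwoObstruction_comp_g (f : (presentationComplex ρ₀).X₁ ⟶ (ideleClassLimitShortComplex K).X₂) :
    shaTwoObstruction ρ₀ n hM (f ≫ (ideleClassLimitShortComplex K).g) = 0 := by
  rw [shaTwoObstruction, AddMonoidHom.comp_apply, obstruction_comp_g, map_zero]

/-- **(b) `Ψ(ι ≫ q) = 0`**: a homomorphism that extends to `ℤ[Gal(E₀/K)]ᵐ` has no obstruction.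
[cite: MilneADT2006, I Theorem 4.10 (proof)] -/
theorem shaTwoObstruction_f_comp (q : (presentationComplex ρ₀).X₂ ⟶ (ideleClassLimitShortComplex K).X₃) :
    shaTwoObstruction ρ₀ n hM ((presentationComplex ρ₀).f ≫ q) = 0 := by
  rw [shaTwoObstruction, AddMonoidHom.comp_apply, obstruction_f_comp, map_zero]

/-- **(c) `Ψ h = 0 ⟹ h` lifts to `J̄`**: by Hilbert 90 at the layers (`Ext¹_{C_Γ}(ℤ[Gal(E₀/K)]ᵐ, F̄ˣ) = 0`, door-c6
`FreePresentation.ext_presLattice_unitsBarD_eq_zero`) and the generic degree-`2` chase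
`ExtPresentation.exists_comp_g_eq_of_obstruction_eq_zero`. [cite: MilneADT2006, I Theorem 4.10 (proof), Lemma 4.13 (proof)] -/
theorem exists_comp_g_eq_of_shaTwoObstruction_eq_zero
    (h : (presentationComplex ρ₀).X₁ ⟶ (ideleClassLimitShortComplex K).X₃) (h0 : shaTwoObstruction ρ₀ n hM h = 0) :
    ∃ f : (presentationComplex ρ₀).X₁ ⟶ (ideleClassLimitShortComplex K).X₂, h = f ≫ (ideleClassLimitShortComplex K).g := by
  rw [shaTwoObstruction, AddMonoidHom.comp_apply, ← (extTwoToTateDual ρ₀ n hM).map_zero] at h0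
  have hi := extTwoToTateDual_injective ρ₀ n hM h0
  obtain ⟨f, hf⟩ := exists_comp_g_eq_of_obstruction_eq_zero (presentationComplex_shortExact ρ₀)
    (ideleClassLimitShortComplex_shortExact K)
    (fun x => ext_presLattice_unitsBarD_eq_zero (presentationLayer ρ₀) (presentationRank ρ₀) x) h hi
  exact ⟨f, hf.symm⟩

/-- **Kernel of `Ψ`**: `Ψ h = 0` iff `h = f ≫ g` for some `f : N₁ → J̄`. [cite: MilneADT2006, I Theorem 4.10 (proof)] -/
theorem shaTwoObstruction_eq_zero_iff (h : (presentationComplex ρ₀).X₁ ⟶ (ideleClassLimitShortComplex K).X₃) :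
    shaTwoObstruction ρ₀ n hM h = 0 ↔
      ∃ f : (presentationComplex ρ₀).X₁ ⟶ (ideleClassLimitShortComplex K).X₂, h = f ≫ (ideleClassLimitShortComplex K).g := by
  refine ⟨exists_comp_g_eq_of_shaTwoObstruction_eq_zero ρ₀ n hM h, ?_⟩
  rintro ⟨f, rfl⟩
  exact shaTwoObstruction_comp_g ρ₀ n hM f

/-- Two homomorphisms `N₁ → C̄` with the same obstruction differ by one that lifts to `J̄`.
[cite: MilneADT2006, I Theorem 4.10 (proof)] -/
theorem shaTwoObstruction_eq_iff (h h' : (presentationComplex ρ₀).X₁ ⟶ (ideleClassLimitShortComplex K).X₃) :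
    shaTwoObstruction ρ₀ n hM h = shaTwoObstruction ρ₀ n hM h' ↔
      ∃ f : (presentationComplex ρ₀).X₁ ⟶ (ideleClassLimitShortComplex K).X₂,
        h = h' + f ≫ (ideleClassLimitShortComplex K).g := by
  rw [← sub_eq_zero, ← map_sub, shaTwoObstruction_eq_zero_iff]
  constructor
  · rintro ⟨f, hf⟩
    exact ⟨f, by rw [← hf, add_sub_cancel]⟩
  · rintro ⟨f, hf⟩
    exact ⟨f, by rw [hf, add_sub_cancel_left]⟩

end ExtTwo

/-! ## §4 The same map with `C̄` SPELLED `classBarD K` (the spelling of the `Ш²`-readout road)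

The road `PoitouTateShaTwoReadout.shaTwo_tateDual_of_ideleProjection` types its degree-`2` input on
`Hom_{C_Γ}(N₁, classBarD K)`, while `T.X₃ = (ideleClassLimitShortComplex K).X₃` is only DEFINITIONALLY `classBarD K`
(`ideleClassLimitShortComplex_X₃`, a deep `rfl`).  To keep every bundled homomorphism syntactically well-typed we
repackage `T` with its third object spelled `classBarD K` (`ideleClassSeq`, reducible) and define the obstruction map on
that spelling (`shaTwoObstruction'`); it agrees with `shaTwoObstruction` pointwise by `rfl` (at a raised recursion
depth: the two spellings of `C̄` unfold through door-c5's layer system). -/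

section ClassBarD

variable (K : Type) [Field K] [NumberField K]

/-- The idèle class sequence `0 → F̄ˣ → J̄ → C̄ → 0` (`ideleClassLimitShortComplex K`) with its third object spelled
`classBarD K` (reducible repackaging; same maps). [cite: MilneADT2006, I §4 (proof of Theorem 4.10)] -/
abbrev ideleClassSeq : ShortComplex (DiscreteRepCat ℤ (absoluteGaloisGroup K)) where
  X₁ := (ideleClassLimitShortComplex K).X₁
  X₂ := (ideleClassLimitShortComplex K).X₂
  X₃ := classBarD K
  f := (ideleClassLimitShortComplex K).f
  g := (ideleClassLimitShortComplex K).g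
  zero := (ideleClassLimitShortComplex K).zero

/-- `ideleClassSeq K` is short exact (it IS door-c5's sequence). [cite: MilneADT2006, I §4 (proof of Theorem 4.10)] -/
theorem ideleClassSeq_shortExact : (ideleClassSeq K).ShortExact :=
  ideleClassLimitShortComplex_shortExact K

variable {K}
variable {M : Type} [AddCommGroup M] [TopologicalSpace M] [DiscreteTopology M] [Finite M]
  (ρ₀ : DiscreteGaloisModule K M) (n : ℕ) (hM : ∀ m : M, n • m = 0)

/-- **`Ψ : Hom_{C_Γ}(N₁, C̄) →+ H²(K, M^D)` on the spelling `C̄ = classBarD K`** (`shaTwoObstruction` through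
`ideleClassSeq`). [cite: MilneADT2006, I Theorem 4.10 (proof)] -/
def shaTwoObstruction' : ((presentationComplex ρ₀).X₁ ⟶ classBarD K) →+ galoisCohomology (ρ₀.tateDual n) 2 :=
  (extTwoToTateDual ρ₀ n hM).comp (obstruction (presentationComplex_shortExact ρ₀) (ideleClassSeq_shortExact K))

set_option maxRecDepth 4096 in
-- the two spellings of `C̄` agree by a deep but finite `rfl`
/-- `shaTwoObstruction'` IS `shaTwoObstruction` (pointwise, definitionally). [cite: MilneADT2006, I Theorem 4.10 (proof)] -/
theorem shaTwoObstruction'_apply (h : (presentationComplex ρ₀).X₁ ⟶ classBarD K) :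
    shaTwoObstruction' ρ₀ n hM h = shaTwoObstruction ρ₀ n hM h := rfl

/-- (a) on the repackaged spelling: `Ψ(f ≫ g) = 0`. [cite: MilneADT2006, I Theorem 4.10 (proof)] -/
theorem shaTwoObstruction'_comp_g' (f : (presentationComplex ρ₀).X₁ ⟶ (ideleClassLimitShortComplex K).X₂) :
    shaTwoObstruction' ρ₀ n hM (f ≫ (ideleClassSeq K).g) = 0 := by
  rw [shaTwoObstruction', AddMonoidHom.comp_apply, obstruction_comp_g, map_zero]

set_option maxRecDepth 4096 in
-- `f ≫ T.g` read in `Hom(N₁, classBarD K)`: the spellings agree by a deep but finite `rfl`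
/-- **(a) `Ψ(f ≫ g) = 0`** in the road's spelling (`f ≫ (ideleClassLimitShortComplex K).g` read as a homomorphism
into `classBarD K`). [cite: MilneADT2006, I Theorem 4.10 (proof)] -/
theorem shaTwoObstruction'_comp_g (f : (presentationComplex ρ₀).X₁ ⟶ (ideleClassLimitShortComplex K).X₂) :
    shaTwoObstruction' ρ₀ n hM (f ≫ (ideleClassLimitShortComplex K).g) = 0 :=
  shaTwoObstruction'_comp_g' ρ₀ n hM f

/-- **(b) `Ψ(ι ≫ q) = 0`** in the road's spelling. [cite: MilneADT2006, I Theorem 4.10 (proof)] -/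
theorem shaTwoObstruction'_f_comp (q : (presentationComplex ρ₀).X₂ ⟶ classBarD K) :
    shaTwoObstruction' ρ₀ n hM ((presentationComplex ρ₀).f ≫ q) = 0 := by
  rw [shaTwoObstruction', AddMonoidHom.comp_apply, obstruction_f_comp, map_zero]

/-- **(c) `Ψ h = 0 ⟹ h` lifts to `J̄`** in the road's spelling. [cite: MilneADT2006, I Theorem 4.10 (proof), Lemma 4.13 (proof)] -/
theorem exists_comp_g_eq_of_shaTwoObstruction'_eq_zero (h : (presentationComplex ρ₀).X₁ ⟶ classBarD K)
    (h0 : shaTwoObstruction' ρ₀ n hM h = 0) :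
    ∃ f : (presentationComplex ρ₀).X₁ ⟶ (ideleClassLimitShortComplex K).X₂, h = f ≫ (ideleClassLimitShortComplex K).g := by
  rw [shaTwoObstruction', AddMonoidHom.comp_apply, ← (extTwoToTateDual ρ₀ n hM).map_zero] at h0
  have hi := extTwoToTateDual_injective ρ₀ n hM h0
  obtain ⟨f, hf⟩ := exists_comp_g_eq_of_obstruction_eq_zero (presentationComplex_shortExact ρ₀)
    (ideleClassSeq_shortExact K)
    (fun x => ext_presLattice_unitsBarD_eq_zero (presentationLayer ρ₀) (presentationRank ρ₀) x) h hi
  exact ⟨f, hf.symm⟩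

set_option maxRecDepth 4096 in
-- the substituted `h = f ≫ T.g` is compared across the two spellings of `C̄`
/-- Kernel of `Ψ` in the road's spelling. [cite: MilneADT2006, I Theorem 4.10 (proof)] -/
theorem shaTwoObstruction'_eq_zero_iff (h : (presentationComplex ρ₀).X₁ ⟶ classBarD K) :
    shaTwoObstruction' ρ₀ n hM h = 0 ↔
      ∃ f : (presentationComplex ρ₀).X₁ ⟶ (ideleClassLimitShortComplex K).X₂, h = f ≫ (ideleClassLimitShortComplex K).g := by
  refine ⟨exists_comp_g_eq_of_shaTwoObstruction'_eq_zero ρ₀ n hM h, ?_⟩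
  rintro ⟨f, rfl⟩
  exact shaTwoObstruction'_comp_g ρ₀ n hM f

end ClassBarD

/-! ## §5 The bridge `nat : H¹(K, M^{DD}) →+ Ext¹_{C_Γ}(ℤ, M)` of the road's (R4) identity

The `Ш²`-readout road (`PoitouTateShaTwoReadout.shaTwo_tateDual_of_ideleProjection`) asks for an additive BIJECTION
`nat : H¹(K, M^{DD}) → Ext¹_{C_Γ}(ℤ, S.X₃)` (`S.X₃ = M` spelled through the presentation) under which the (R4) pairing
identity holds.  The canonical candidate is door-c4's comparison `Ext¹_{C_Γ}(ℤ, M) ≃ H¹(K, M)`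
(`extTrivAddEquivGaloisCohomology ρ₀ 1`) inverted, preceded by `H¹(κ)` for an inverse-of-biduality `κ : M^{DD} → M`
(`exists_bidual_intertwining`).  We define it (`natOfBidual`) and prove it bijective; the (R4) identity for THIS `nat` is
the E-side reciprocity sum of cell `bsd-schneider` (not proved here). -/

section NatBridge

open scoped ContRepresentation
open DiscreteGaloisModule (TateDual)

variable {K : Type} [Field K] [NumberField K]
variable {M : Type} [AddCommGroup M] [TopologicalSpace M] [DiscreteTopology M] [Finite M]
  (ρ₀ : DiscreteGaloisModule K M) (n : ℕ)

/-- **`H¹(K, M) →+ Ext¹_{C_Γ}(ℤ, S.X₃)`**: door-c4's `(extTrivAddEquivGaloisCohomology ρ₀ 1)⁻¹` followed by the change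
of spelling `ofDiscreteGaloisModule ρ₀ ≅ (presentationComplex ρ₀).X₃` (`presX₃Iso`). [cite: Harari2020, §4.3, Remark 4.24] -/
def galoisCohomologyOneToExt :
    galoisCohomology ρ₀ 1 →+ Ext (triv (Γ := absoluteGaloisGroup K) ℤ) (presentationComplex ρ₀).X₃ 1 :=
  haveI := absoluteGaloisGroup_compactSpace K
  ((Ext.mk₀ (presX₃Iso ρ₀).hom).postcomp (triv (Γ := absoluteGaloisGroup K) ℤ) (add_zero 1)).comp
    (extTrivAddEquivGaloisCohomology ρ₀ 1).symm.toAddMonoidHom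

/-- `galoisCohomologyOneToExt` is bijective (an equivalence followed by post-composition with an isomorphism).
[cite: Harari2020, §4.3, Remark 4.24] -/
theorem galoisCohomologyOneToExt_bijective : Bijective (galoisCohomologyOneToExt ρ₀) := by
  haveI := absoluteGaloisGroup_compactSpace K
  have hpost : Bijective fun x : Ext (triv (Γ := absoluteGaloisGroup K) ℤ) (ofDiscreteGaloisModule ρ₀) 1 =>
      x.comp (Ext.mk₀ (presX₃Iso ρ₀).hom) (add_zero 1) := by
    refine Function.bijective_iff_has_inverse.2 ⟨fun z => z.comp (Ext.mk₀ (presX₃Iso ρ₀).inv) (add_zero 1),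
      fun x => ?_, fun z => ?_⟩
    · simp only [Ext.comp_assoc_of_second_deg_zero, Ext.mk₀_comp_mk₀, Iso.hom_inv_id, Ext.comp_mk₀_id]
    · simp only [Ext.comp_assoc_of_second_deg_zero, Ext.mk₀_comp_mk₀, Iso.inv_hom_id, Ext.comp_mk₀_id]
  exact hpost.comp (extTrivAddEquivGaloisCohomology ρ₀ 1).symm.bijective

omit [NumberField K] [Finite M] in
/-- `H¹(κ) ∘ H¹(ι) = id` when `κ ∘ ι = id` (degree-one functoriality on crossed homomorphisms).
[cite: SerreGaloisCohomology1997, I §2.2] -/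
theorem map_one_map_one_eq_self {M' : Type} [AddCommGroup M'] [TopologicalSpace M'] [DiscreteTopology M']
    {ρ' : DiscreteGaloisModule K M'} (ι : ρ₀.toContRepresentation →ⁱL ρ'.toContRepresentation)
    (κ : ρ'.toContRepresentation →ⁱL ρ₀.toContRepresentation) (hκι : ∀ m : M, κ (ι m) = m)
    (x : galoisCohomology ρ₀ 1) : galoisCohomology.map κ 1 (galoisCohomology.map ι 1 x) = x := by
  obtain ⟨φ, rfl⟩ := oneCocycleClass_surjective _ x
  have h1 : galoisCohomology.map ι 1 (oneCocycleClass ρ₀.toTopRep φ) =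
      oneCocycleClass ρ'.toTopRep (contOneCocycles.pullback (ContinuousMonoidHom.id (absoluteGaloisGroup K))
        (X := ρ₀.toTopRep) (Y := ρ'.toTopRep) (TopRep.ofHom ⟨ι.toContinuousLinearMap, ι.isIntertwining'⟩) φ) :=
    map_oneCocycleClass _ _ _ φ
  rw [h1]
  refine (map_oneCocycleClass _ _ _ _).trans (congrArg (oneCocycleClass _) (Subtype.ext (ContinuousMap.ext ?_)))
  intro σ
  exact hκι (φ.1 σ)

variable [Finite (TateDual K M n)]

/-- **`nat := Φ⁻¹ ∘ H¹(κ) : H¹(K, M^{DD}) →+ Ext¹_{C_Γ}(ℤ, S.X₃)`** for an inverse-of-biduality `κ : M^{DD} → M` — the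
canonical bridge of the `Ш²`-readout road's (R4) identity. [cite: MilneADT2006, I Theorem 4.10 (proof, p. 58), Prop. 0.19] -/
def natOfBidual (κ : ((ρ₀.tateDual n).tateDual n).toContRepresentation →ⁱL ρ₀.toContRepresentation) :
    galoisCohomology ((ρ₀.tateDual n).tateDual n) 1 →+
      Ext (triv (Γ := absoluteGaloisGroup K) ℤ) (presentationComplex ρ₀).X₃ 1 :=
  (galoisCohomologyOneToExt ρ₀).comp (galoisCohomology.map κ 1)

/-- **`natOfBidual` is bijective** for a biduality pair `(ι, κ)` (`κ ∘ ι = id`, `ι ∘ κ = id`).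
[cite: MilneADT2006, I Prop. 0.19][cite: Harari2020, §4.3, Remark 4.24] -/
theorem natOfBidual_bijective (ι : ρ₀.toContRepresentation →ⁱL ((ρ₀.tateDual n).tateDual n).toContRepresentation)
    (κ : ((ρ₀.tateDual n).tateDual n).toContRepresentation →ⁱL ρ₀.toContRepresentation)
    (hκι : ∀ m : M, κ (ι m) = m) (hικ : ∀ φ : TateDual K (TateDual K M n) n, ι (κ φ) = φ) :
    Bijective (natOfBidual ρ₀ n κ) := by
  have hκ : Bijective (galoisCohomology.map κ 1) :=
    Function.bijective_iff_has_inverse.2 ⟨galoisCohomology.map ι 1,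
      fun y => map_one_map_one_eq_self ((ρ₀.tateDual n).tateDual n) κ ι hικ y,
      fun x => map_one_map_one_eq_self ρ₀ ι κ hκι x⟩
  exact (galoisCohomologyOneToExt_bijective ρ₀).comp hκ

end NatBridge

end HomDual

end Literature.NumberTheory.GaloisRepresentations

end
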